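import Summits.Ventures.HSemireg.ContractionRankWeilPurity
import Summits.Ventures.HSemireg.ContractionRankWeil
import Summits.Ventures.HSemireg.ContractionSpanTwist
import Summits.Ventures.HSemireg.AmplificationChainG4Transport
import HarnessLib

/-!
# Venture HSemireg — the g = 4 rank row with `r(P, ch E)` EVALUATED to `18` IN THE WEIL FRAME OF `P` ITSELF
# (route (a): th-7's purity locus ∘ seat p6's twist invariance ∘ seat p7's functor-free row; no Fourier transport)

HONEST FRAMING. Lean index of the computation cell `pub-hsemireg` (seat p4). Compositions of kernel theorems over the
carriers of `PerfectComplexRankDoor.lean` (`contractionRank`, `totalExteriorClass`, `hodgeZeroOne`); every geometric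
identification is a hypothesis BY VALUE, exactly as in `ContractionRankWeil.lean` / `ContractionRankWeilPurity.lean`.
Nothing here is a claim about any explicit variety; nothing here says that HC / HC_CM / HC_AV holds (split Weil abelian
fourfolds are IN PRINT, [Markman2023GeneralizedKummers] Thm. 1.5 (= Thm. 13.4), p. 236 — «Thm. 1.3» in the arXiv:1805.11574
numbering — and are RE-DERIVED modulo the named hypotheses exactly as in `AmplificationChainG4Transport.lean`).
Everything is PROVED; no `def`, no named fact, no `sorry`.

WHAT THIS FILE DOES. `ContractionRankPartialFourier.lean` evaluated the right side of the census certificate (I2-β)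
«`dim Ext²(𝓔,𝓔) = 18 ≤ r(A₀, ch 𝓔) = 18`» (g = 4 object `𝓔 = E₀ ⊗ M_B` on `A₀ = X × X̂`, `step0/T4a/README-T4a.md`) through the
Künneth / shear / PARTIAL-FOURIER layer (the class read on `X × X`). THIS file evaluates the same number DIRECTLY ON `A₀`, in an
ADAPTED WEIL FRAME of `H¹(A₀)` (FORMULA-N PART B §L; th-7): by th-7's wedge-model reading of `README-T4a` §2 (theory/th7/purity/
t4a_probe.py; th-2's dictionary G4ROW-BYVALUE-th2.md), `ch(E₀) = Ecl bV q 4 + a·w₊ + b·w₋` with the TWO-EXPONENTIAL h-part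
`q_j = c₁λ^j + c₂μ^j`, `c₁ = c₂ = −1`, `λ = 0`, `μ = −1` (so `q = (−2, 1, −1, 1, −1)`) and `ab = 1 = c₁c₂(λ−μ)⁴` — the PURITY LOCUS
of `ContractionRankWeilPurity.contractionRank_weil_purity_two` (18 on / 20 off). So:
1. **`contractionRank_eq_eighteen_of_weilFrame`**: Weil frame `hL` + untwisted class `κ₀` on the purity locus (`hx₀`, `hloc`)
   + a twist `Σ κ_p = (Σ κ₀_p) ∧ e^{c}`, `c ∈ span{v ∧ q : q ∈ H^{0,1}}`, `c^N = 0` (seat p6's `contractionRank_eq_of_totalExteriorClass_eq_mul_expSum`;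
   `c = c₁(M_B)` BY VALUE) ⟹ `contractionRank A κ = 18`.
2. **`contractionRank_eq_eighteen_of_weilFrame_T4a`**: item 1 at th-7's T4a parameters (`q_j = −0^j − (−1)^j`, `ab = 1`);
   **`contractionRank_eq_of_weilFrame_twist`**: the `n ≥ 3` companion (THEOREM R `contractionRank_weil` ∘ twist: any h-part `q`,
   `ab ≠ 0` ⟹ `(4 + rank H₂(q))·n² − 2n`, e.g. `48` for a T4a-type object on `X × X̂` with `X` an abelian THREEFOLD — no locus for `n ≥ 3`).
3. **`weilFourfoldsSplit_of_reach_of_perfectComplexRankTransfer_of_extRank_eq_of_weilFrame`**: seat p7's functor-free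
   g = 4 TIER-2 row (`AmplificationChainG4Transport.lean` §3, red-5 V16) with the rank binder in the NUMERAL form
   `h2 : extRank Y₀ G 2 ≤ 18` plus the frame binders of item 1 for `κ = ch(E)`; every other binder verbatim.
With `ContractionRankPartialFourier.lean` this gives TWO kernel evaluations of (I2-β)'s right side from two different by-value
layers (there: Künneth splitting, shear, partial-Fourier class identity; here: the adapted Weil frame and th-7's `(q; a, b)`);
th-2's `ht2rank4` and gs-eng-2 remain the ×2 by direct computation on the operator family.
SATISFIABILITY CHECK for T4a (seat script `HOME/p4/weilframe/t4a_weilframe_check.py` 2b53adf2d3861bb3 → `.out.txt`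
bf88291724419260, exact exterior-algebra arithmetic over `ℚ`, < 1 s): with `e₁…e₄` an integral basis of `H¹(X)`, `λ₁…λ₄` the dual
basis of `H¹(X̂)` (`c₁(𝒫) = Σ eᵢλᵢ`, `README-T4a` §2), `(p₁,p₂,q₁,q₂) = M·e` ANY splitting (`p` of type (1,0), `q` of type (0,1);
six invertible `M` tested, `det M` cancels) and `(u₁,u₂,v₁,v₂) = M^{−T}·λ` the dual vectors (`u_k ∈ H^{0,1}(X̂)`, `v_k ∈ H^{1,0}(X̂)`),
the adapted basis `bV' = (u₁,u₂,q₁,q₂ ; −p₁,−p₂,v₁,v₂)` has `Lsp bV' = H^{0,1}(A₀)`, `Σ ℓ_a ∧ m_a = c₁(𝒫)`, and `README-T4a` §2's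
`ch(E₀) = −2 + Σ eᵢλᵢ + pt_X + pt_X̂ + Σ_{i<j} e_ie_jλ_iλ_j − Σ_{|I|=3} e_Iλ_I − e₁₂₃₄λ₁₂₃₄` EQUALS `Ecl bV' (−2,1,−1,1,−1) 4 + a·wUp bV' 2 +
b·wLow bV' 2` with `a = −1/det M`, `b = −det M`, hence `ab = +1` — ON the locus (th-7's sign question of 2026-08-22T20:07Z settled
by value; the frame built from `−λ` fails the identity, as a control): `hx₀`/`hab` below ARE instantiable for the cell's object.
BY VALUE: the adapted Weil frame `bV` with `hL`, the class identity `hx₀` (which `(q; a, b)` a given sheaf has is NOT derived in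
the tree), the twist `htw`, `dim Ext²(𝓔,𝓔) = 18`; BY NAME: `weilFamilyReach_hyperbolic` (refereed), `PerfectComplexRankTransfer C`
(assumption; F-1). References: [BuchweitzFlenner2008HH] Prop. 6.4.4; [MumfordAV1970] §1 (4), §4 (iii); [Fulton1998] Example 3.2.3
and §15.1 (`ch(E ⊗ E′) = ch(E)·ch(E′)`, `ch(L) = e^{c₁(L)}` for a line bundle, so `ch(E ⊗ M) = ch(E)·e^{c₁(M)}` — the twist `htw`,
BY VALUE as in `ContractionSpanTwist.lean`; in the autoequivalence setting also [GolyshevLuntsOrlov2001MirrorAV] Lemma 4.1.5.1,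
`ρ_X(⊗L) = ∪ch(L)` — locators by seat lit-w-mukai); [Markman2023GeneralizedKummers] Thm. 1.5 (= 13.4).
-/

noncomputable section

open CategoryTheory AlgebraicGeometry Set
open ExteriorAlgebra (ι)
open Module
open Literature.AlgebraicGeometry.Motives Literature.AlgebraicGeometry.HodgeTheory
open Literature.AlgebraicGeometry.ModuliOfAbelianVarieties Literature.AlgebraicGeometry.Deligne1982
open Literature.AlgebraicGeometry.KTheory
open Literature.AlgebraicTopology.SingularHomology

namespace Summit.Ventures.HSemireg

/-! ## §1 `r = 18` in the Weil frame: purity locus ∘ twist -/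

section WeilFrame

variable {A : AbelianVariety ℂ}

/-- **`r(A, κ) = 18` for a TWISTED Weil-frame class on the purity locus (g = 4).** Frame BY VALUE: an adapted basis `bV` of
`H¹(A)` whose first `4` vectors span `H^{0,1}(A)` (`hL`); untwisted class `κ₀` with total class
`Ecl bV q 4 + a·w₊ + b·w₋`, `q_j = c₁λ^j + c₂μ^j`, `λ ≠ μ`, `c₁ c₂ a b ≠ 0`, ON the locus `ab = c₁c₂(λ−μ)⁴` (`hx₀`, `hloc`);
twist `Σ κ_p = (Σ κ₀_p) ∧ Σ_{k<N} c^k/k!` with `c ∈ span{v ∧ q : q ∈ H^{0,1}(A)}`, `c^N = 0` (`htw`; e.g. `c = c₁(M_B)`).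
Conclusion `contractionRank A κ = 18` (seat p6's twist invariance ∘ `contractionRank_weil_purity_two_on`).
[cite: BuchweitzFlenner2008HH, Prop. 6.4.4] [cite: MumfordAV1970, §1 (4) and §4 (iii)] -/
theorem contractionRank_eq_eighteen_of_weilFrame (hA : IsSmoothProjective A.dim A.X)
    (κ₀ κ : ∀ p : ℕ, complexBetti A.X (2 * p))
    (bV : Basis (Fin (2 + 2 + (2 + 2))) ℂ (complexBetti A.X 1)) (hL : hodgeZeroOne hA = WedgeBridge.Lsp bV)
    {c₁ c₂ lam mu a b : ℂ} (h1 : c₁ ≠ 0) (h2 : c₂ ≠ 0) (hlm : lam ≠ mu) (ha : a ≠ 0) (hb : b ≠ 0)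
    (hloc : a * b = c₁ * c₂ * (lam - mu) ^ 4)
    (hx₀ : totalExteriorClass A κ₀ =
      WedgeBridge.Ecl bV (fun j => c₁ * lam ^ j + c₂ * mu ^ j) (2 + 2) + a • WeilCarrier.wUp bV 2 +
        b • WeilCarrier.wLow bV 2)
    {c : ExteriorAlgebra ℂ (complexBetti A.X 1)}
    (hc : c ∈ Submodule.span ℂ {z : ExteriorAlgebra ℂ (complexBetti A.X 1) |
      ∃ v : complexBetti A.X 1, ∃ q ∈ hodgeZeroOneSet A, z = ι ℂ v * ι ℂ q}) {N : ℕ} (hN : c ^ N = 0)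
    (htw : totalExteriorClass A κ = totalExteriorClass A κ₀ * ∑ k ∈ Finset.range N, ((k.factorial : ℂ)⁻¹) • c ^ k) :
    contractionRank A κ = 18 := by
  rw [contractionRank_eq_of_totalExteriorClass_eq_mul_expSum A hc hN htw]
  exact contractionRank_weil_purity_two_on hA κ₀ bV hL h1 h2 hlm ha hb hloc hx₀

/-- th-7's T4a h-part sequence `q_j = −0^j − (−1)^j` is `(−2, 1, −1, 1, −1, …)` (`README-T4a` §2 read in the adapted Weil
frame: `ch(E₀) = −e^{0·Θ} − e^{−Θ} + pt_X + pt_X̂`). [cite: MumfordAV1970, §1 (4) and §4 (iii)] -/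
theorem weilFrame_T4a_seq :
    (fun j : ℕ => (-1 : ℂ) * 0 ^ j + (-1) * (-1) ^ j) 0 = -2 ∧ (fun j : ℕ => (-1 : ℂ) * 0 ^ j + (-1) * (-1) ^ j) 1 = 1 ∧
      (fun j : ℕ => (-1 : ℂ) * 0 ^ j + (-1) * (-1) ^ j) 2 = -1 ∧ (fun j : ℕ => (-1 : ℂ) * 0 ^ j + (-1) * (-1) ^ j) 3 = 1 ∧
        (fun j : ℕ => (-1 : ℂ) * 0 ^ j + (-1) * (-1) ^ j) 4 = -1 := by
  norm_num

/-- **`r(A, κ) = 18` at th-7's T4a parameters:** untwisted class `Ecl bV (j ↦ −0^j − (−1)^j) 4 + a·w₊ + b·w₋` with `ab = 1`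
(`c₁ = c₂ = −1`, `λ = 0`, `μ = −1`; the locus `ab = c₁c₂(λ−μ)⁴` reads `ab = 1`), then the twist as above ⟹ `18`. WHICH
`(q; a, b)` the cell's sheaf `E₀` has is the by-value input `hx₀` (th-7 / th-2), not derived here.
[cite: BuchweitzFlenner2008HH, Prop. 6.4.4] [cite: MumfordAV1970, §1 (4) and §4 (iii)] -/
theorem contractionRank_eq_eighteen_of_weilFrame_T4a (hA : IsSmoothProjective A.dim A.X)
    (κ₀ κ : ∀ p : ℕ, complexBetti A.X (2 * p))
    (bV : Basis (Fin (2 + 2 + (2 + 2))) ℂ (complexBetti A.X 1)) (hL : hodgeZeroOne hA = WedgeBridge.Lsp bV)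
    {a b : ℂ} (hab : a * b = 1)
    (hx₀ : totalExteriorClass A κ₀ =
      WedgeBridge.Ecl bV (fun j => (-1 : ℂ) * 0 ^ j + (-1) * (-1) ^ j) (2 + 2) + a • WeilCarrier.wUp bV 2 +
        b • WeilCarrier.wLow bV 2)
    {c : ExteriorAlgebra ℂ (complexBetti A.X 1)}
    (hc : c ∈ Submodule.span ℂ {z : ExteriorAlgebra ℂ (complexBetti A.X 1) |
      ∃ v : complexBetti A.X 1, ∃ q ∈ hodgeZeroOneSet A, z = ι ℂ v * ι ℂ q}) {N : ℕ} (hN : c ^ N = 0)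
    (htw : totalExteriorClass A κ = totalExteriorClass A κ₀ * ∑ k ∈ Finset.range N, ((k.factorial : ℂ)⁻¹) • c ^ k) :
    contractionRank A κ = 18 := by
  have ha : a ≠ 0 := left_ne_zero_of_mul_eq_one hab
  have hb : b ≠ 0 := right_ne_zero_of_mul_eq_one hab
  have hloc : a * b = (-1 : ℂ) * (-1) * ((0 : ℂ) - (-1)) ^ 4 := by rw [hab]; norm_num
  exact contractionRank_eq_eighteen_of_weilFrame hA κ₀ κ bV hL (by norm_num) (by norm_num) (by norm_num) ha hb hloc hx₀ hc
    hN htw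

/-- **`n ≥ 3` companion (THEOREM R ∘ twist):** Weil type `(n, n)`, `n ≥ 3`, adapted basis `bV` of `H¹(A)` (`hL`), untwisted
class `Ecl bV q (2n) + a·w₊ + b·w₋` with ANY h-part `q` and `a, b ≠ 0` (`hx₀`), then a twist as above (`htw`):
`contractionRank A κ = 4n² + n²·rank H₂(q) − 2n` (`48` at `n = 3`, `ρ = 2` — e.g. a T4a-type object on `X × X̂` for an abelian
threefold `X`, `q_j = −0^j − (−1)^j`; there is no purity locus for `n ≥ 3`). [cite: BuchweitzFlenner2008HH, Prop. 6.4.4]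
[cite: MumfordAV1970, §1 (4) and §4 (iii)] -/
theorem contractionRank_eq_of_weilFrame_twist (hA : IsSmoothProjective A.dim A.X)
    (κ₀ κ : ∀ p : ℕ, complexBetti A.X (2 * p)) {n : ℕ} (hn : 3 ≤ n)
    (bV : Basis (Fin (n + n + (n + n))) ℂ (complexBetti A.X 1)) (hL : hodgeZeroOne hA = WedgeBridge.Lsp bV)
    (q : ℕ → ℂ) {a b : ℂ} (ha : a ≠ 0) (hb : b ≠ 0)
    (hx₀ : totalExteriorClass A κ₀ =
      WedgeBridge.Ecl bV q (n + n) + a • WeilCarrier.wUp bV n + b • WeilCarrier.wLow bV n)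
    {c : ExteriorAlgebra ℂ (complexBetti A.X 1)}
    (hc : c ∈ Submodule.span ℂ {z : ExteriorAlgebra ℂ (complexBetti A.X 1) |
      ∃ v : complexBetti A.X 1, ∃ q ∈ hodgeZeroOneSet A, z = ι ℂ v * ι ℂ q}) {N : ℕ} (hN : c ^ N = 0)
    (htw : totalExteriorClass A κ = totalExteriorClass A κ₀ * ∑ k ∈ Finset.range N, ((k.factorial : ℂ)⁻¹) • c ^ k) :
    contractionRank A κ =
      ((4 * (n * n) + n * n * (Wedge.Hankel.hankel1 ℂ (n + n) 2 q).rank - 2 * n : ℕ) : Cardinal) := by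
  rw [contractionRank_eq_of_totalExteriorClass_eq_mul_expSum A hc hN htw]
  exact contractionRank_weil hA κ₀ hn bV hL q ha hb hx₀

end WeilFrame

/-! ## §2 The g = 4 TIER-2 rank row with `r(P, ch E)` evaluated in the Weil frame of `P` -/

section G4

open Summit.HodgeConjecture.HodgeConjecture
open Summit.HodgeConjecture.HodgeConjecture.WeilTypeLadder
open Summit.HodgeConjecture.HodgeConjecture.Cruxes.HodgeAbelianVarieties.EStepSecantInduction
open Summit.Ventures.HSemireg.GeneralStructure

variable {C : ChernCharacterBetti}

/-- **g = 4, TIER 2, functor-free, `r` EVALUATED in the Weil frame of `P`**: seat p7's row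
`weilFourfoldsSplit_of_reach_of_perfectComplexRankTransfer_of_extRank_eq` with `h2 : extRank Y₀ G 2 ≤ 18` — the right side
of (I2-β) supplied by `contractionRank_eq_eighteen_of_weilFrame` from the frame binders BY VALUE: an adapted Weil basis `bV`
of `H¹(P)` (`hL`), the untwisted class `κ₀` (`= ch E₀`) of Weil-frame shape on the purity locus (`hx₀`, `hloc`; for the cell:
th-7's T4a parameters), and the twist `htw` for `κ = ch(E)` (`ch 𝓔 = ch E₀ ∧ e^{c₁(M_B)}`). Everything else verbatim;
`hF'`/`hT` BY NAME as there. [cite: Markman2023GeneralizedKummers, Thm. 1.5 (= Thm. 13.4), p. 236 (arXiv:1805.11574 numbering: Thm. 1.3)]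
[cite: BuchweitzFlenner2008HH, Prop. 6.4.4] [cite: MumfordAV1970, §1 (4) and §4 (iii)] -/
theorem weilFourfoldsSplit_of_reach_of_perfectComplexRankTransfer_of_extRank_eq_of_weilFrame
    (hF' : weilFamilyReach_hyperbolic) (hT : PerfectComplexRankTransfer C) {d : ℕ} (hd : 0 < d)
    (P : AbelianVariety ℂ) (ψ₀ : P ⟶ P) (e : ProjectiveEmbedding P.X) (a : complexBetti (projectiveSpace e.n ℂ) 2)
    (hP : P.dim = 2 * 2) (hψ : ψ₀ ≫ ψ₀ = -(d • 𝟙 P)) (ha : IsRationalClass a) (ha0 : a ≠ 0)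
    (hhyp : IsHyperbolicWeilType P ψ₀ 2 (symmetrisedClass d P ψ₀ e a))
    (w : complexBetti P.X (2 * 2)) (hwW : w ∈ weilClassesOf P ψ₀ 2 d) (hwr : IsRationalClass w) (hw0 : w ≠ 0)
    (I : Finset ℕ) (hI : ∀ p : ℕ, 1 ≤ p → p ≤ 2 * 2 → p ∈ I) (E : CochainComplex P.X.left.Modules ℤ)
    (hE : IsBoundedVBComplex E) (q : ℚ) (cq : ℕ → ℚ)
    (hch2 : chPerfect C P.X E hE.isFiniteLocallyFree 2 = ((q : ℚ) : ℂ) • cupPowTwo (symmetrisedClass d P ψ₀ e a) 2 + w)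
    (hchp : ∀ p ∈ I, p ≠ 2 →
      chPerfect C P.X E hE.isFiniteLocallyFree p = ((cq p : ℚ) : ℂ) • cupPowTwo (symmetrisedClass d P ψ₀ e a) p)
    {Y₀ : SchemeOver ℂ} (G : CochainComplex Y₀.left.Modules ℤ)
    (hext : ∀ m : ℤ, m ≤ 2 → extRank P.X E m = extRank Y₀ G m)
    (hneg : ∀ k : ℤ, k < 0 → extRank Y₀ G k = 0) (h0 : extRank Y₀ G 0 = 1)
    (h2 : extRank Y₀ G 2 ≤ 18)
    -- the Weil frame of `P` and the untwisted class (BY VALUE)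
    (hPs : IsSmoothProjective P.dim P.X) (κ₀ : ∀ p : ℕ, complexBetti P.X (2 * p))
    (bV : Basis (Fin (2 + 2 + (2 + 2))) ℂ (complexBetti P.X 1)) (hL : hodgeZeroOne hPs = WedgeBridge.Lsp bV)
    {c₁ c₂ lam mu aW bW : ℂ} (h1 : c₁ ≠ 0) (hc2 : c₂ ≠ 0) (hlm : lam ≠ mu) (haW : aW ≠ 0) (hbW : bW ≠ 0)
    (hloc : aW * bW = c₁ * c₂ * (lam - mu) ^ 4)
    (hx₀ : totalExteriorClass P κ₀ =
      WedgeBridge.Ecl bV (fun j => c₁ * lam ^ j + c₂ * mu ^ j) (2 + 2) + aW • WeilCarrier.wUp bV 2 +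
        bW • WeilCarrier.wLow bV 2)
    -- the twist (BY VALUE)
    {c : ExteriorAlgebra ℂ (complexBetti P.X 1)}
    (hc : c ∈ Submodule.span ℂ {z : ExteriorAlgebra ℂ (complexBetti P.X 1) |
      ∃ v : complexBetti P.X 1, ∃ q ∈ hodgeZeroOneSet P, z = ι ℂ v * ι ℂ q}) {N : ℕ} (hN : c ^ N = 0)
    (htw : totalExteriorClass P (fun p ↦ chPerfect C P.X E hE.isFiniteLocallyFree p) =
      totalExteriorClass P κ₀ * ∑ k ∈ Finset.range N, ((k.factorial : ℂ)⁻¹) • c ^ k) :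
    Stubs.WeilAlgebraicSplitHyperplane 2 d := by
  have hr : contractionRank P (fun p ↦ chPerfect C P.X E hE.isFiniteLocallyFree p) = 18 :=
    contractionRank_eq_eighteen_of_weilFrame hPs κ₀ _ bV hL h1 hc2 hlm haW hbW hloc hx₀ hc hN htw
  refine weilFourfoldsSplit_of_reach_of_perfectComplexRankTransfer_of_extRank_eq hF' hT hd P ψ₀ e a hP hψ ha ha0 hhyp
    w hwW hwr hw0 I hI E hE q cq hch2 hchp G hext hneg h0 ?_
  rw [hr, Cardinal.lift_ofNat]
  exact h2

end G4

/-! ## Audit: nothing is decided here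

KERNEL: `r(P, ch E) = 18` from the class shape IN THE WEIL FRAME (th-7 purity locus, wave-2 enclosure `WedgeWeilPurityLocus` /
p6 `WedgeWeilCarrierPurity` / `ContractionRankWeilPurity`, ∘ p6 twist), composed into p7's functor-free row. BY VALUE: the
adapted Weil frame `bV`/`hL`, the parameters `(c₁, c₂, λ, μ; a, b)` and the class identity `hx₀`, `htw`, the Weil datum, the
Chern data, `extRank … 0 = 1`, `extRank … 2 ≤ 18` (= `dim Ext² = 18`), `hext`. BY NAME: `weilFamilyReach_hyperbolic` (refereed),
`PerfectComplexRankTransfer C` (assumption; no kernel link to Pridham / Perry — F-1). -/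

end Summit.Ventures.HSemireg

end
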